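import Summits.BirchSwinnertonDyer.BirchSwinnertonDyer.Theorems.ResidualThetaTransportAtTwoResidualSignedLambdaLowerCMAtTwoCharIdealLambdaBlocks
import Summits.BirchSwinnertonDyer.BirchSwinnertonDyer.Theorems.ResidualThetaTransportAtTwoLambdaLowerBoundO
import Literature.NumberTheory.EllipticCurves.Kato2004.ZetaQuotientPackageCoeff
import HarnessLib

/-!
# The λ-invariant of a torsion `A⟦X⟧`-module from its height-one lengths, and H-λchar:
# characteristic ideals equal up to constants ⇒ equal `dim_K (K ⊗_A ·)` (`A` a complete DVR, `K = Frac A`)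

Route `ResidualThetaTransportAtTwo` (RTT), crux RSL_g `ResidualSignedLambdaLowerCMAtTwo` (stmt-BirchSwinnertonDyer-22608):
STUB-PLAN rev 3 §3 Step 1 (algebra kit: A3 `FinrankMonoOfLengthLe`, k2-g2 H-λchar `FinrankEqOfCharIdealEqUpToConst`).
Seat `prover-bsd-wall-rtt-p2` g15 (`--supports`, closes nothing). Sequel of `…CharIdealLengths`, `…CharIdealLambdaBlocks`. THEOREMS ONLY; pure
commutative algebra; BSD is not proved by any of this.

## What (`Λ = A⟦X⟧`, `A` a complete discrete valuation ring with uniformiser `ϖ`, `K` its fraction field)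
* (§0–§1 are the prequel `…CharIdealLambdaBlocks`: blocks `dim_K (K ⊗_A Λ/(gᵉ)) = e · dim_K (K ⊗_A Λ/𝔮)` by Weierstrass
  preparation, and pseudo-isomorphism invariance.)
* §2 **`finrank_baseChange_eq_finsum_lengthAt`** — for a finitely generated torsion `Λ`-module `M`:
  `dim_K (K ⊗_A M) = Σ_{ht 𝔭 = 1} ℓ_𝔭(M) · dim_K (K ⊗_A Λ/𝔭)` (Washington §13.2 "λ = Σ nⱼ deg fⱼ", coefficient version):
  the tree's generic structure theorem `Module.exists_isPseudoIsomorphism_pi` (pseudo-isomorphism `M → Π Λ/(gᵢ^{eᵢₖ})`),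
  invariance of both sides under pseudo-isomorphism (`…CharIdealLengths`), and §1 blockwise.
* §3 **H-λchar `finrank_baseChange_eq_of_span_C_mul_charIdeal_eq`**: `(C c)·char(M) = (C d)·char(N)` with `c, d ∈ A ∖ 0`
  ⇒ `dim_K (K ⊗_A M) = dim_K (K ⊗_A N)` (A1 of `…CharIdealLengths` at the primes `𝔭 ∌ C ϖ`; the primes `𝔭 ∋ C ϖ` have
  weight `dim_K (K ⊗_A Λ/𝔭) = 0`); **A3 `finrank_baseChange_le_of_lengthAt_le`**: `ℓ_𝔭(M) ≤ ℓ_𝔭(N)` at all height-one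
  `𝔭 ∌ C ϖ` ⇒ `dim_K (K ⊗_A M) ≤ dim_K (K ⊗_A N)`. This is k2-g2's `FinrankEqOfCharIdealEqUpToConst`
  (`Cruxes/ResidualThetaCountLowerPureAtTwo/Sketch_sidea_k2_g2.lean`) for COMPLETE `A` — the case of S2 (`A = 𝒪_λ`); for a
  non-complete DVR the identity of §2 fails through `Module.finrank` junk values (e.g. `ℤ_(p)⟦X⟧/((X−p)X)`), which is why
  completeness is assumed.

* §4 The same in the crux's currencies: `rank_A(M/M_tors) = rank_A(N/N_tors)` (via
  `LambdaLowerBoundO.finrank_baseChange_eq_finrank_quotientTorsion`, for `A`-finitely generated `M, N` — the finite branch of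
  S2), and verbatim over `𝒪 = padicCoeffIntegers S`, `Λ_𝒪 = IwasawaAlgebraO S` (`ℚ_p(S)/ℚ_p` finite), the carriers of
  `cmLambdaLower_of_corank` and of `Kato2004.ZetaQuotientPackageCoeff`.
* §5 **`finrank_baseChange_H2_eq_zetaQuotient_of_charIdealEqUpToConst`** — plug-and-play form on Kato's package:
  for `P : Kato2004.ZetaQuotientPackage I` over a complete DVR `A` with `P.CharIdealEqUpToConst` (= BT26 Thm. 2.6 as the
  route will type it) and `𝐇¹_Γ(T)` finitely generated (Kato 12.4), `dim_K (K ⊗_A 𝐇²) = dim_K (K ⊗_A 𝐇¹/Z)` — node N4 of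
  `RSLG-LINE-DAG-g14.md` becomes `λ(𝐇²) = λ(𝐇¹/Z)` with no further algebra.

References: [Washington1997] §13.2 (Thm. 13.12, Prop. 13.8; remark on `𝒪`); [BourbakiAC5to7] VII §4.4 Thm. 5;
[Lang1990] Ch. 5 §2 (Weierstrass preparation); [BurungaleTian2026] Thm. 2.6 (the consumer, via `CharIdealEqUpToConst`).
-/

set_option autoImplicit false
-- the Theorems namespace of this sub repeats the summit name by design (D-0017 nested layout)
set_option linter.dupNamespace false

noncomputable section

open scoped TensorProduct Classical

namespace Summit.BirchSwinnertonDyer.BirchSwinnertonDyer.Theorems.CharIdealLambda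

open Literature.NumberTheory.EllipticCurves

universe u v v' w

section Complete

variable {A : Type u} [CommRing A] [IsDomain A] [IsDiscreteValuationRing A]
  [IsAdicComplete (IsLocalRing.maximalIdeal A) A]
variable (K : Type w) [Field K] [Algebra A K] [IsFractionRing A K]

/-! ## §2 `dim_K (K ⊗_A M) = Σ_{ht 𝔭 = 1} ℓ_𝔭(M) · dim_K (K ⊗_A Λ/𝔭)` -/

/-- The height-one primes at which a finitely generated torsion module over a Noetherian domain has non-zero length all
contain its (non-zero) annihilator; they form a finite set. [cite: BourbakiAC5to7, Ch. VII §4 no. 4 Thm. 3] -/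
theorem annihilator_le_of_lengthAt_ne_zero {R : Type u} [CommRing R] {M : Type v} [AddCommGroup M] [Module R M]
    (𝔭 : PrimeSpectrum R) (h : Module.lengthAt R M 𝔭 ≠ 0) : Module.annihilator R M ≤ 𝔭.asIdeal := by
  by_contra hle
  obtain ⟨s, hs, hs𝔭⟩ := Set.not_subset.mp hle
  exact h (Module.lengthAt_eq_zero_of_isTorsionBy (fun m ↦ Module.mem_annihilator.mp hs m) 𝔭 hs𝔭)

/-- **The λ-invariant from the height-one lengths** (Washington §13.2, `λ(M) = Σ nⱼ deg fⱼ`, with coefficients): for a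
finitely generated torsion module `M` over `Λ = A⟦X⟧`, `A` a complete DVR with fraction field `K`,
`dim_K (K ⊗_A M) = Σ_{ht 𝔭 = 1} ℓ_𝔭(M) · dim_K (K ⊗_A Λ/𝔭)` (a finite sum: the primes `𝔭 ∋ C ϖ` contribute `0`, the
others `ℓ_𝔭(M)·deg 𝔭`). Proof: the tree's structure theorem `Module.exists_isPseudoIsomorphism_pi` (a pseudo-isomorphism
`M → Π_i Π_k Λ/(g_i^{e_ik})` over the height-one support, `Λ` being factorial), invariance of both sides under
pseudo-isomorphisms, and the block computation. [cite: Washington1997, §13.2 (Thm. 13.12, Prop. 13.8)]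
[cite: BourbakiAC5to7, Ch. VII §4 no. 4 Thm. 5] -/
theorem finrank_baseChange_eq_finsum_lengthAt (M : Type v) [AddCommGroup M] [Module (PowerSeries A) M] [Module A M]
    [IsScalarTower A (PowerSeries A) M] [Module.Finite (PowerSeries A) M] (hM : Module.IsTorsion (PowerSeries A) M) :
    Module.finrank K (K ⊗[A] M) =
      ∑ᶠ 𝔭 ∈ {𝔭 : PrimeSpectrum (PowerSeries A) | 𝔭.asIdeal.height = 1},
        (Module.lengthAt (PowerSeries A) M 𝔭).toNat * Module.finrank K (K ⊗[A] (PowerSeries A ⧸ 𝔭.asIdeal)) := by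
  -- generators of the height-one primes (`Λ` is a UFD)
  have hprinc : ∀ 𝔮 : PrimeSpectrum (PowerSeries A), 𝔮.asIdeal.height = 1 → ∃ g : PowerSeries A,
      𝔮.asIdeal = Ideal.span {g} := fun 𝔮 h ↦ by
    haveI := UniqueFactorizationMonoid.isPrincipal_of_height_eq_one (p := 𝔮.asIdeal) h
    exact Submodule.IsPrincipal.principal 𝔮.asIdeal
  let gen : PrimeSpectrum (PowerSeries A) → PowerSeries A := fun 𝔮 ↦
    if h : 𝔮.asIdeal.height = 1 then Classical.choose (hprinc 𝔮 h) else 0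
  have hgen : ∀ 𝔮 : PrimeSpectrum (PowerSeries A), 𝔮.asIdeal.height = 1 →
      Module.annihilator (PowerSeries A) M ≤ 𝔮.asIdeal → 𝔮.asIdeal = Ideal.span {gen 𝔮} := by
    intro 𝔮 h _
    simp only [gen, dif_pos h]
    exact Classical.choose_spec (hprinc 𝔮 h)
  obtain ⟨n, q, hqinj, hq, r, e, -, θ, hθ⟩ := Module.exists_isPseudoIsomorphism_pi M hM gen hgen
  have hqgen : ∀ i, (q i).asIdeal = Ideal.span {gen (q i)} := fun i ↦ hgen _ (hq i).1 (hq i).2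
  have hg0 : ∀ i, gen (q i) ≠ 0 := fun i h0 ↦ by
    have := (hq i).1
    rw [hqgen i, h0, Ideal.span_singleton_zero, Ideal.height_bot] at this
    exact zero_ne_one this
  -- abbreviations
  set deg : PrimeSpectrum (PowerSeries A) → ℕ := fun 𝔭 ↦ Module.finrank K (K ⊗[A] (PowerSeries A ⧸ 𝔭.asIdeal)) with hdeg
  -- the blocks are finite-dimensional after base change, of dimension `e_ik · deg(q_i)`
  have hblock : ∀ i k, Module.Finite K (K ⊗[A] (PowerSeries A ⧸ Ideal.span {gen (q i) ^ e i k})) ∧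
      Module.finrank K (K ⊗[A] (PowerSeries A ⧸ Ideal.span {gen (q i) ^ e i k})) = e i k * deg (q i) :=
    fun i k ↦ finite_and_finrank_baseChange_quotient_span_pow K (q i) (hq i).1 (hqgen i) (e i k)
  haveI : ∀ i k, Module.Finite K (K ⊗[A] (PowerSeries A ⧸ Ideal.span {gen (q i) ^ e i k})) := fun i k ↦ (hblock i k).1
  haveI : ∀ i, Module.Finite K (K ⊗[A] (Π k : Fin (r i), PowerSeries A ⧸ Ideal.span {gen (q i) ^ e i k})) := fun i ↦
    Module.Finite.equiv
      (TensorProduct.piRight A K K (fun k : Fin (r i) ↦ PowerSeries A ⧸ Ideal.span {gen (q i) ^ e i k})).symm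
  haveI : ∀ i k, Module.Free K (K ⊗[A] (PowerSeries A ⧸ Ideal.span {gen (q i) ^ e i k})) := fun i k ↦
    Module.Free.of_divisionRing K _
  haveI : ∀ i, Module.Free K (K ⊗[A] (Π k : Fin (r i), PowerSeries A ⧸ Ideal.span {gen (q i) ^ e i k})) := fun i ↦
    Module.Free.of_divisionRing K _
  -- LHS: pass to the elementary module and sum the blocks
  have hL : Module.finrank K (K ⊗[A] M) = ∑ i, (∑ k, e i k) * deg (q i) := by
    rw [finrank_baseChange_eq_of_isPseudoIsomorphism' K θ hθ,
      (TensorProduct.piRight A K K (fun i ↦ Π k : Fin (r i), PowerSeries A ⧸ Ideal.span {gen (q i) ^ e i k})).finrank_eq,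
      Module.finrank_pi_fintype]
    refine Finset.sum_congr rfl fun i _ ↦ ?_
    rw [(TensorProduct.piRight A K K (fun k : Fin (r i) ↦ PowerSeries A ⧸ Ideal.span {gen (q i) ^ e i k})).finrank_eq,
      Module.finrank_pi_fintype, Finset.sum_mul]
    exact Finset.sum_congr rfl fun k _ ↦ (hblock i k).2
  -- lengths of the elementary module
  have hlenE : ∀ 𝔭 : PrimeSpectrum (PowerSeries A), 𝔭.asIdeal.height = 1 →
      Module.lengthAt (PowerSeries A) (Π i, Π k : Fin (r i), PowerSeries A ⧸ Ideal.span {gen (q i) ^ e i k}) 𝔭 =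
        ∑ i, if 𝔭 = q i then ((∑ k, e i k : ℕ) : ℕ∞) else 0 := by
    intro 𝔭 h𝔭
    rw [Module.lengthAt_pi]
    refine Finset.sum_congr rfl fun i _ ↦ ?_
    rw [Module.lengthAt_pi]
    have hqi : Module.lengthAt (PowerSeries A) (PowerSeries A ⧸ Ideal.span {gen (q i)}) 𝔭 = if 𝔭 = q i then 1 else 0 := by
      split_ifs with h
      · subst h; rw [← hqgen i]; exact Module.lengthAt_quotient_self _
      · refine Module.lengthAt_quotient_eq_zero_of_not_le fun hle ↦ h ?_
        rw [← hqgen i] at hle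
        have hne : (q i).asIdeal ≠ ⊥ := by
          rw [Ne, ← Ideal.height_eq_zero_iff_eq_bot, (hq i).1]; exact one_ne_zero
        exact (PrimeSpectrum.ext (Module.eq_of_height_le_one_of_le (le_of_eq h𝔭) hne hle)).symm
    simp_rw [Module.lengthAt_quotient_span_singleton_pow (hg0 i), hqi]
    split_ifs
    · simp
    · simp
  -- RHS: the summand vanishes off `range q` and equals `(Σ_k e_ik)·deg(q_i)` at `q_i`
  set F : PrimeSpectrum (PowerSeries A) → ℕ := fun 𝔭 ↦ (Module.lengthAt (PowerSeries A) M 𝔭).toNat * deg 𝔭 with hF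
  have hFq : ∀ i, F (q i) = (∑ k, e i k) * deg (q i) := by
    intro i
    simp only [hF]
    rw [Module.lengthAt_eq_of_isPseudoIsomorphism hθ (q i) (le_of_eq (hq i).1), hlenE (q i) (hq i).1,
      Finset.sum_eq_single i (fun j _ hji ↦ if_neg (fun h ↦ hji (hqinj h).symm)) (fun h ↦ absurd (Finset.mem_univ i) h),
      if_pos rfl, ENat.toNat_coe]
  have hF0 : ∀ 𝔭 ∈ {𝔭 : PrimeSpectrum (PowerSeries A) | 𝔭.asIdeal.height = 1}, F 𝔭 ≠ 0 → 𝔭 ∈ Set.range q := by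
    intro 𝔭 h𝔭 hne
    have hlen : Module.lengthAt (PowerSeries A) M 𝔭 ≠ 0 := fun h0 ↦ hne (by simp only [hF, h0, ENat.toNat_zero, zero_mul])
    rw [Module.lengthAt_eq_of_isPseudoIsomorphism hθ 𝔭 (le_of_eq h𝔭), hlenE 𝔭 h𝔭] at hlen
    obtain ⟨i, -, hi⟩ := Finset.exists_ne_zero_of_sum_ne_zero hlen
    exact ⟨i, (of_not_not fun h ↦ hi (if_neg h)).symm⟩
  rw [hL, finsum_mem_eq_sum_of_subset F (t := Finset.univ.image q) ?_ ?_, Finset.sum_image fun i _ j _ h ↦ hqinj h]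
  · exact Finset.sum_congr rfl fun i _ ↦ (hFq i).symm
  · rintro 𝔭 ⟨h𝔭, hne⟩
    obtain ⟨i, rfl⟩ := hF0 𝔭 h𝔭 hne
    exact Finset.mem_coe.mpr (Finset.mem_image_of_mem q (Finset.mem_univ i))
  · intro 𝔭 h𝔭
    obtain ⟨i, -, rfl⟩ := Finset.mem_image.mp (Finset.mem_coe.mp h𝔭)
    exact (hq i).1

/-! ## §3 H-λchar and A3 -/

omit [IsDiscreteValuationRing A] [IsAdicComplete (IsLocalRing.maximalIdeal A) A] in
/-- A prime of `A⟦X⟧` containing `C ϖ` has weight `dim_K (K ⊗_A Λ/𝔭) = 0`. [folklore] -/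
theorem finrank_baseChange_quotient_eq_zero_of_C_mem {ϖ : A} (hϖ : ϖ ≠ 0) (𝔭 : PrimeSpectrum (PowerSeries A))
    (h : (PowerSeries.C ϖ : PowerSeries A) ∈ 𝔭.asIdeal) : Module.finrank K (K ⊗[A] (PowerSeries A ⧸ 𝔭.asIdeal)) = 0 := by
  haveI := subsingleton_baseChange_of_pow_smul_eq_zero K hϖ (Q := PowerSeries A ⧸ 𝔭.asIdeal) 1
    (pow_smul_eq_zero_of_C_pow_mem (by rwa [pow_one]))
  exact Module.finrank_zero_of_subsingleton

omit [IsAdicComplete (IsLocalRing.maximalIdeal A) A] in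
/-- A non-zero constant `C c` lies in a prime `𝔭` of `A⟦X⟧` only if `C ϖ` does (`c = u·ϖᵏ`). [folklore] -/
theorem C_mem_of_C_mem {ϖ : A} (hϖ : Irreducible ϖ) {c : A} (hc : c ≠ 0) (𝔭 : PrimeSpectrum (PowerSeries A))
    (h : (PowerSeries.C c : PowerSeries A) ∈ 𝔭.asIdeal) : (PowerSeries.C ϖ : PowerSeries A) ∈ 𝔭.asIdeal := by
  obtain ⟨k, u, rfl⟩ := IsDiscreteValuationRing.eq_unit_mul_pow_irreducible hc hϖ
  rw [map_mul, map_pow] at h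
  rcases 𝔭.isPrime.mem_or_mem h with hu | hk
  · exact absurd (Ideal.eq_top_of_isUnit_mem _ hu (u.isUnit.map _)) 𝔭.isPrime.ne_top
  · exact 𝔭.isPrime.mem_of_pow_mem _ hk

/-- **H-λchar (k2-g2 `FinrankEqOfCharIdealEqUpToConst`, complete-DVR form): characteristic ideals equal UP TO NON-ZERO
CONSTANTS of `A` give equal λ-invariants `dim_K (K ⊗_A ·)`.** For finitely generated torsion `M, N` over `Λ = A⟦X⟧`
(`A` a complete DVR, `K = Frac A`) and `c, d ∈ A ∖ 0` with `(C c)·char(M) = (C d)·char(N)`: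
`dim_K (K ⊗_A M) = dim_K (K ⊗_A N)`. This is the bridge from the currency of `Kato2004.ZetaQuotientPackage.CharIdealEqUpToConst`
(Burungale–Tian 2026 Thm. 2.6 as typed) to the λ-bookkeeping of `LambdaLowerBoundO` (p625690, `cmLambdaLower_of_corank`).
[cite: Washington1997, §13.2] [cite: BurungaleTian2026, Thm. 2.6 (p. 5)] -/
theorem finrank_baseChange_eq_of_span_C_mul_charIdeal_eq (M : Type v) (N : Type v') [AddCommGroup M]
    [Module (PowerSeries A) M] [Module A M] [IsScalarTower A (PowerSeries A) M] [Module.Finite (PowerSeries A) M]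
    [AddCommGroup N] [Module (PowerSeries A) N] [Module A N] [IsScalarTower A (PowerSeries A) N]
    [Module.Finite (PowerSeries A) N] (hM : Module.IsTorsion (PowerSeries A) M) (hN : Module.IsTorsion (PowerSeries A) N)
    {c d : A} (hc : c ≠ 0) (hd : d ≠ 0)
    (h : Ideal.span {PowerSeries.C c} * Module.charIdeal (PowerSeries A) M =
      Ideal.span {PowerSeries.C d} * Module.charIdeal (PowerSeries A) N) :
    Module.finrank K (K ⊗[A] M) = Module.finrank K (K ⊗[A] N) := by
  obtain ⟨ϖ, hϖ⟩ := IsDiscreteValuationRing.exists_irreducible A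
  have hC : ∀ {a : A}, a ≠ 0 → (PowerSeries.C a : PowerSeries A) ≠ 0 := fun ha h0 ↦
    ha (by simpa using congrArg PowerSeries.constantCoeff h0)
  rw [finrank_baseChange_eq_finsum_lengthAt K M hM, finrank_baseChange_eq_finsum_lengthAt K N hN]
  refine finsum_mem_congr rfl fun 𝔭 h𝔭 ↦ ?_
  by_cases hϖ𝔭 : (PowerSeries.C ϖ : PowerSeries A) ∈ 𝔭.asIdeal
  · rw [finrank_baseChange_quotient_eq_zero_of_C_mem K hϖ.ne_zero 𝔭 hϖ𝔭, mul_zero, mul_zero]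
  · rw [lengthAt_eq_of_span_singleton_mul_charIdeal_eq hM hN (hC hc) (hC hd) h 𝔭 h𝔭
      (fun h ↦ hϖ𝔭 (C_mem_of_C_mem hϖ hc 𝔭 h)) (fun h ↦ hϖ𝔭 (C_mem_of_C_mem hϖ hd 𝔭 h))]

omit [IsDomain A] [IsDiscreteValuationRing A] [IsAdicComplete (IsLocalRing.maximalIdeal A) A] [IsFractionRing A K] in
/-- The λ-sum of §2 is carried by any finite set `T` of height-one primes containing the height-one support. [folklore] -/
theorem finsum_lengthAt_mul_eq_sum (T : Finset (PrimeSpectrum (PowerSeries A)))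
    (hT : ∀ 𝔭 ∈ T, 𝔭.asIdeal.height = 1) (X : Type v) [AddCommGroup X] [Module (PowerSeries A) X]
    (hX : ∀ 𝔭 : PrimeSpectrum (PowerSeries A), 𝔭.asIdeal.height = 1 → Module.lengthAt (PowerSeries A) X 𝔭 ≠ 0 → 𝔭 ∈ T) :
    ∑ᶠ 𝔭 ∈ {𝔭 : PrimeSpectrum (PowerSeries A) | 𝔭.asIdeal.height = 1},
        (Module.lengthAt (PowerSeries A) X 𝔭).toNat * Module.finrank K (K ⊗[A] (PowerSeries A ⧸ 𝔭.asIdeal)) =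
      ∑ 𝔭 ∈ T, (Module.lengthAt (PowerSeries A) X 𝔭).toNat * Module.finrank K (K ⊗[A] (PowerSeries A ⧸ 𝔭.asIdeal)) := by
  refine finsum_mem_eq_sum_of_subset _ ?_ ?_
  · rintro 𝔭 ⟨h𝔭, hne⟩
    exact hX 𝔭 h𝔭 (fun h0 ↦ hne (by simp [h0]))
  · exact fun 𝔭 h𝔭 ↦ hT 𝔭 h𝔭

/-- **A3 `FinrankMonoOfLengthLe`: smaller lengths at every height-one prime `𝔭 ∌ C ϖ` give a smaller λ-invariant.**
For finitely generated torsion `M, N` over `Λ = A⟦X⟧` (`A` a complete DVR with uniformiser `ϖ`, `K = Frac A`):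
`(∀ 𝔭, ht 𝔭 = 1 → C ϖ ∉ 𝔭 → ℓ_𝔭(M) ≤ ℓ_𝔭(N)) → dim_K (K ⊗_A M) ≤ dim_K (K ⊗_A N)`. [cite: Washington1997, §13.2] -/
theorem finrank_baseChange_le_of_lengthAt_le {ϖ : A} (hϖ : Irreducible ϖ) (M : Type v) (N : Type v') [AddCommGroup M]
    [Module (PowerSeries A) M] [Module A M] [IsScalarTower A (PowerSeries A) M] [Module.Finite (PowerSeries A) M]
    [AddCommGroup N] [Module (PowerSeries A) N] [Module A N] [IsScalarTower A (PowerSeries A) N]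
    [Module.Finite (PowerSeries A) N] (hM : Module.IsTorsion (PowerSeries A) M) (hN : Module.IsTorsion (PowerSeries A) N)
    (h : ∀ 𝔭 : PrimeSpectrum (PowerSeries A), 𝔭.asIdeal.height = 1 → (PowerSeries.C ϖ : PowerSeries A) ∉ 𝔭.asIdeal →
      Module.lengthAt (PowerSeries A) M 𝔭 ≤ Module.lengthAt (PowerSeries A) N 𝔭) :
    Module.finrank K (K ⊗[A] M) ≤ Module.finrank K (K ⊗[A] N) := by
  rw [finrank_baseChange_eq_finsum_lengthAt K M hM, finrank_baseChange_eq_finsum_lengthAt K N hN]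
  -- a common finite set of height-one primes carrying both sums
  have hIM := Module.annihilator_ne_bot_of_isTorsion M hM
  have hIN := Module.annihilator_ne_bot_of_isTorsion N hN
  have hfin : ({𝔭 : PrimeSpectrum (PowerSeries A) | 𝔭.asIdeal.height = 1 ∧
      (Module.annihilator (PowerSeries A) M ≤ 𝔭.asIdeal ∨ Module.annihilator (PowerSeries A) N ≤ 𝔭.asIdeal)}).Finite := by
    refine ((Module.finite_setOf_height_le_one_le _ hIM).union (Module.finite_setOf_height_le_one_le _ hIN)).subset ?_
    rintro 𝔭 ⟨h1, h2 | h2⟩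
    · exact Or.inl ⟨le_of_eq h1, h2⟩
    · exact Or.inr ⟨le_of_eq h1, h2⟩
  have hT : ∀ 𝔭 ∈ hfin.toFinset, 𝔭.asIdeal.height = 1 := fun 𝔭 h𝔭 ↦ ((Set.Finite.mem_toFinset _).mp h𝔭).1
  rw [finsum_lengthAt_mul_eq_sum K _ hT M (fun 𝔭 h1 hne ↦
      (Set.Finite.mem_toFinset _).mpr ⟨h1, Or.inl (annihilator_le_of_lengthAt_ne_zero 𝔭 hne)⟩),
    finsum_lengthAt_mul_eq_sum K _ hT N (fun 𝔭 h1 hne ↦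
      (Set.Finite.mem_toFinset _).mpr ⟨h1, Or.inr (annihilator_le_of_lengthAt_ne_zero 𝔭 hne)⟩)]
  refine Finset.sum_le_sum fun 𝔭 h𝔭 ↦ ?_
  have h1 := hT 𝔭 h𝔭
  by_cases hϖ𝔭 : (PowerSeries.C ϖ : PowerSeries A) ∈ 𝔭.asIdeal
  · rw [finrank_baseChange_quotient_eq_zero_of_C_mem K hϖ.ne_zero 𝔭 hϖ𝔭, mul_zero, mul_zero]
  · obtain ⟨a, ha, ha0⟩ := Submodule.annihilator_top_inter_nonZeroDivisors hN
    rw [SetLike.mem_coe, Submodule.annihilator_top] at ha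
    have hNt := Module.lengthAt_ne_top_of_isTorsionBy (nonZeroDivisors.ne_zero ha0)
      (fun x ↦ Module.mem_annihilator.mp ha x) 𝔭 (le_of_eq h1) (M := N)
    exact Nat.mul_le_mul_right _ (ENat.toNat_le_toNat (h 𝔭 h1 hϖ𝔭) hNt)

/-! ## §4 The crux's currencies: `rank_A(·/torsion)` and `𝒪 = padicCoeffIntegers S`, `Λ_𝒪 = IwasawaAlgebraO S` -/

/-- **H-λchar in the `rank_A(M/M_tors)` currency** (the `hcorank`/`hAD` currency of `LambdaLowerBoundO.cmLambdaLower_of_corank`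
and k2-g2's `le_finrank_quotientTorsion_of_flatFourTerm`): for `A`-finitely generated (the finite branch: `μ = 0`) torsion
`Λ`-modules `M, N` with `(C c)·char(M) = (C d)·char(N)`, `c d ≠ 0`: `rank_A(M/M_tors) = rank_A(N/N_tors)`.
[cite: Washington1997, §13.2] [cite: BurungaleTian2026, Thm. 2.6 (p. 5)] -/
theorem finrank_quotientTorsion_eq_of_span_C_mul_charIdeal_eq (M : Type v) (N : Type v') [AddCommGroup M]
    [Module (PowerSeries A) M] [Module A M] [IsScalarTower A (PowerSeries A) M] [Module.Finite (PowerSeries A) M]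
    [Module.Finite A M] [AddCommGroup N] [Module (PowerSeries A) N] [Module A N] [IsScalarTower A (PowerSeries A) N]
    [Module.Finite (PowerSeries A) N] [Module.Finite A N] (hM : Module.IsTorsion (PowerSeries A) M)
    (hN : Module.IsTorsion (PowerSeries A) N) {c d : A} (hc : c ≠ 0) (hd : d ≠ 0)
    (h : Ideal.span {PowerSeries.C c} * Module.charIdeal (PowerSeries A) M =
      Ideal.span {PowerSeries.C d} * Module.charIdeal (PowerSeries A) N) :
    Module.finrank A (M ⧸ Submodule.torsion A M) = Module.finrank A (N ⧸ Submodule.torsion A N) := by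
  rw [← LambdaLowerBoundO.finrank_baseChange_eq_finrank_quotientTorsion (FractionRing A) M,
    ← LambdaLowerBoundO.finrank_baseChange_eq_finrank_quotientTorsion (FractionRing A) N]
  exact finrank_baseChange_eq_of_span_C_mul_charIdeal_eq (FractionRing A) M N hM hN hc hd h

end Complete

section CruxCurrency

open Literature.NumberTheory.Automorphic

/-- **H-λchar on the crux's carriers** `𝒪 = padicCoeffIntegers S`, `Λ_𝒪 = IwasawaAlgebraO S` (`ℚ_p(S)/ℚ_p` finite; for S2:
`p = 2`, `S = Set.range ι`): for `𝒪`-finitely generated torsion `Λ_𝒪`-modules `M, N` and `c, d ∈ 𝒪 ∖ 0` with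
`(C c)·char(M) = (C d)·char(N)` — the conclusion shape of `Kato2004.ZetaQuotientPackage.CharIdealEqUpToConst` —
`rank_𝒪(M/M_tors) = rank_𝒪(N/N_tors)`. (`𝒪` is a complete DVR: `LambdaLowerBoundO.isDiscreteValuationRing_unitBall`,
`isAdicComplete_maximalIdeal_unitBall`, transported along `padicCoeffIntegers_eq_unitBall`.)
[cite: Washington1997, §13.2] [cite: BurungaleTian2026, Thm. 2.6 (p. 5)] -/
theorem finrank_quotientTorsion_eq_of_span_C_mul_charIdeal_eq_iwasawaAlgebraO {p : ℕ} [Fact p.Prime]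
    (S : Set (PadicAlgCl p)) [FiniteDimensional ℚ_[p] (padicCoeffField S)] :
    ∀ (M N : Type v) [AddCommGroup M] [Module (IwasawaAlgebraO S) M] [Module (padicCoeffIntegers S) M]
      [IsScalarTower (padicCoeffIntegers S) (IwasawaAlgebraO S) M] [Module.Finite (IwasawaAlgebraO S) M]
      [Module.Finite (padicCoeffIntegers S) M] [AddCommGroup N] [Module (IwasawaAlgebraO S) N]
      [Module (padicCoeffIntegers S) N] [IsScalarTower (padicCoeffIntegers S) (IwasawaAlgebraO S) N]
      [Module.Finite (IwasawaAlgebraO S) N] [Module.Finite (padicCoeffIntegers S) N],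
      Module.IsTorsion (IwasawaAlgebraO S) M → Module.IsTorsion (IwasawaAlgebraO S) N →
      ∀ (c d : padicCoeffIntegers S), c ≠ 0 → d ≠ 0 →
        Ideal.span {(PowerSeries.C c : IwasawaAlgebraO S)} * Module.charIdeal (IwasawaAlgebraO S) M =
          Ideal.span {(PowerSeries.C d : IwasawaAlgebraO S)} * Module.charIdeal (IwasawaAlgebraO S) N →
        Module.finrank (padicCoeffIntegers S) (M ⧸ Submodule.torsion (padicCoeffIntegers S) M) =
          Module.finrank (padicCoeffIntegers S) (N ⧸ Submodule.torsion (padicCoeffIntegers S) N) := by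
  unfold IwasawaAlgebraO
  rw [padicCoeffIntegers_eq_unitBall S]
  intro M N _ _ _ _ _ _ _ _ _ _ _ _ hM hN c d hc hd h
  haveI := LambdaLowerBoundO.isDiscreteValuationRing_unitBall p (padicCoeffField S)
  haveI := LambdaLowerBoundO.isAdicComplete_maximalIdeal_unitBall p (padicCoeffField S)
  exact finrank_quotientTorsion_eq_of_span_C_mul_charIdeal_eq M N hM hN hc hd h

end CruxCurrency

section KatoPackage

open Literature.NumberTheory.GaloisRepresentations Literature.NumberTheory.EllipticCurves.Kato2004

/-- **N4 in λ-currency: Burungale–Tian's identity of characteristic ideals up to constants gives `λ(𝐇²) = λ(𝐇¹/Z)`.**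
For Kato's package `P` (abstract `𝐇²_Γ(T)`, zeta span `Z ⊂ 𝐇¹_Γ(T)`) over a complete DVR `A` with fraction field `F`,
`𝐇¹_Γ(T)` finitely generated over `A⟦X⟧` (Kato Thm. 12.4) and `P.CharIdealEqUpToConst` (the typed shape of BT26 Thm. 2.6):
`dim_F (F ⊗_A 𝐇²) = dim_F (F ⊗_A 𝐇¹_Γ(T)/Z)`, for any `A`-module structures on `𝐇²`, `𝐇¹_Γ(T)` compatible with the
`A⟦X⟧`-structures (e.g. restriction of scalars, `Module.compHom` + `IsScalarTower.of_compHom`).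
[cite: BurungaleTian2026, Thm. 2.6 (p. 5)] [cite: Kato2004Asterisque, Thm. 12.4 (p. 221) and §12.10 (p. 223)] -/
theorem finrank_baseChange_H2_eq_zetaQuotient_of_charIdealEqUpToConst {A : Type} [CommRing A] [TopologicalSpace A]
    [IsDomain A] [IsDiscreteValuationRing A] [IsAdicComplete (IsLocalRing.maximalIdeal A) A] {V : Type}
    [AddCommGroup V] [Module A V] [TopologicalSpace V] [IsTopologicalAddGroup V] [ContinuousSMul A V]
    {T : GaloisRep ℚ A V} {p : ℕ} [Fact p.Prime] {κ : ZpExtension ℚ p} {γ : Field.absoluteGaloisGroup ℚ}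
    {I : IwasawaH1DataCoeff T p κ γ} (hI : Module.Finite (PowerSeries A) I.H) [Module A I.H]
    [IsScalarTower A (PowerSeries A) I.H] (P : ZetaQuotientPackage I) [Module A P.H2]
    [IsScalarTower A (PowerSeries A) P.H2] (hP : P.CharIdealEqUpToConst)
    (F : Type w) [Field F] [Algebra A F] [IsFractionRing A F] :
    Module.finrank F (F ⊗[A] P.H2) = Module.finrank F (F ⊗[A] (I.H ⧸ P.Z)) := by
  obtain ⟨c, d, hc, hd, h⟩ := hP.exists_const_mul_eq
  haveI := hI
  haveI : Module.Finite (PowerSeries A) P.H2 := P.finite_H2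
  exact finrank_baseChange_eq_of_span_C_mul_charIdeal_eq F P.H2 (I.H ⧸ P.Z) P.isTorsion_H2 P.isTorsion_quotient hc hd h

end KatoPackage

end Summit.BirchSwinnertonDyer.BirchSwinnertonDyer.Theorems.CharIdealLambda

end
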